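import Mathlib
import HarnessLib
import Summits.RiemannHypothesis.RiemannHypothesis.Theses.EarlyAppointments
import Summits.RiemannHypothesis.RiemannHypothesis.Theorems.EarlyAppointmentsRemainder0XiRho2V4Objects
import Summits.RiemannHypothesis.RiemannHypothesis.Theorems.EarlyAppointmentsRemainder0XiStubFarLogKernelSharp4
import Summits.RiemannHypothesis.RiemannHypothesis.Theorems.EarlyAppointmentsRemainder0XiFarAbelSkeleton
import Summits.RiemannHypothesis.RiemannHypothesis.Theorems.EarlyAppointmentsRemainder0XiLedgerLeaf4KTables
import Summits.RiemannHypothesis.RiemannHypothesis.Theorems.EarlyAppointmentsRemainder0XiNearPartnerLeaf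
import Summits.RiemannHypothesis.RiemannHypothesis.Theorems.EarlyAppointmentsRemainder0XiKernelShiftLeafClose
import Summits.RiemannHypothesis.RiemannHypothesis.Theorems.EarlyAppointmentsRemainder0XiAbelMainLeafClose

/-!
# ⟨24730⟩ `Remainder0Xi` (crux r3 of route EarlyAppointments, line rho2_v4) — THE CLOSING FILE

C4 «kernel desk» rh-idea-6 g31 (files-only), 2026-08-30.  SUPPORT/CLOSING module: no `sorry`, standard axioms.
This is the LAST file of the ρ2 landing table (row 21): it lands only after rows 1–20 (C4 g30/g31 images) and C3 g41's
row 12 `…LedgerLeaf4KTables` (v3 65eae66f) are in the tree, and then it proves the route item BY NAME: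

* the three analytic leaves of the `FarAbel4` skeleton (`…FarAbelSkeleton.farAbel4_of_leaves`) at C3's priced table
  `K4C = ⟨cS, a, b, cN⟩ = ⟨105/10000, 3105/100000, 3/100, 1/10^6⟩`:
  `kernelShiftLeaf_K4C` (row 18 `KernelShiftLeafClose.kernelShiftLeaf_of`, needs `105/10000 ≤ cS`),
  `abelMainLeaf_K4C` (row 20 `AbelMainLeafClose.abelMainLeaf_of`, needs `3105/100000 ≤ a`, `3/100 ≤ b`),
  `nearPartnerLeaf_K4C` (row 6 `NearPartnerLeaf.nearPartnerLeaf_of`, needs `1/10^6 ≤ cN`);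
  the fourth leaf `LedgerLeaf4 K4C` ((cS + a)·L + b + cN ≤ (3/10)·L/(2π) for L ≥ 26) is C3's `ledgerLeaf4_K4C`, consumed
  inside `farAbel4_of_three_leaves_K4C`;
* ★ `farAbel4 : FarAbel4` — v4 STUB 1 (‖FAR(w) − MAIN(Re w)‖ ≤ (3/10)/s(γ) on the box |Re w − γ| ≤ 135/2, |Im w| ≤ 1/2,
  Ξ(w) ≠ 0, γ > T_PT), also at the wide table `K4W` (`farAbel4_K4W`) as a robustness check;
* v4 STUB 2 `FarLogKernelSharp4` (|MAIN(x)| ≤ (1/2 − 3/10)/s(γ)) is row 2's `Rho2V4.stub_farLogKernelSharp4`;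
* `remainder0Xi_assembly4` — the registry's triangle-inequality assembly (`Cruxes/Remainder0Xi/Lines/rho2_v4.lean`
  781062ed, l.72–88) VERBATIM on the Theorems side (the registry cannot be imported from `Theorems/`; its objects
  `farField`, `errorBudget4`, `FarAbel4`, `FarLogKernelSharp4` are the byte-identical mirrors of row 1 `…Rho2V4Objects`);
* ★★★ `remainder0Xi : Summit.RiemannHypothesis.RiemannHypothesis.Theses.EarlyAppointments.Remainder0Xi` — the route
  decl BY NAME (the gate's proof-of-item match for stmt-RiemannHypothesis-24730), and `remainder0Xi_text` = its body
  spelled verbatim.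

What this file does NOT do: it does not touch the other cruxes of EarlyAppointments (`HeightPT` ⟨33347⟩,
`TiltedLandingLaw421R` ⟨33346⟩, the residual `WindowRows421R`) — the route's `closes` still needs them.
Nothing here bears on the truth of RH; RH is NOT proved.  24730 closes only when this file LANDS (rows 1–20 + C3 row 12
first); 33346 / 33347 remain OPEN; 24248 PROVED.
-/

set_option linter.dupNamespace false

namespace Summit.RiemannHypothesis.RiemannHypothesis.Theorems.EarlyAppointmentsRemainder0Xi.Close

open Literature.NumberTheory.LFunctions (riemannXiUpper)
open Summit.RiemannHypothesis.RiemannHypothesis.Cruxes.Remainder0Xi.Rho2V2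
  (T_PT xiSpacing boxHalfWidth eta0 lowStart mainIntegral)
open Summit.RiemannHypothesis.RiemannHypothesis.Cruxes.Remainder0Xi.Rho2V4
  (farField errorBudget4 FarAbel4 FarLogKernelSharp4 stub_farLogKernelSharp4)
open Summit.RiemannHypothesis.RiemannHypothesis.Theorems.EarlyAppointmentsRemainder0Xi.FarAbelSkeleton
  (LeafConsts KernelShiftLeaf AbelMainLeaf NearPartnerLeaf LedgerLeaf4 farAbel4_of_leaves)
open Summit.RiemannHypothesis.RiemannHypothesis.Theorems.EarlyAppointmentsRemainder0Xi.LedgerLeaf4KTables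
  (K4C K4W ledgerLeaf4_K4C ledgerLeaf4_K4W farAbel4_of_three_leaves_K4C farAbel4_of_three_leaves_K4W)

/-! ## The three analytic leaves at C3's table `K4C` (and at the wide table `K4W`) -/

/-- LEAF 1 (kernel shift, row 18) at `K4C.cS = 105/10000`. -/
theorem kernelShiftLeaf_K4C : KernelShiftLeaf K4C :=
  KernelShiftLeafClose.kernelShiftLeaf_of K4C (by norm_num [K4C])

/-- LEAF 2 (Abel main term, row 20) at `K4C.a = 3105/100000`, `K4C.b = 3/100`. -/
theorem abelMainLeaf_K4C : AbelMainLeaf K4C :=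
  AbelMainLeafClose.abelMainLeaf_of K4C (by norm_num [K4C]) (by norm_num [K4C])

/-- LEAF 3 (near partners, row 6) at `K4C.cN = 1/10^6`. -/
theorem nearPartnerLeaf_K4C : NearPartnerLeaf K4C :=
  NearPartnerLeaf.nearPartnerLeaf_of K4C (by norm_num [K4C])

/-- LEAF 1 at C3's wide table `K4W` (`cS = 11/1000 ≥ 105/10000`). -/
theorem kernelShiftLeaf_K4W : KernelShiftLeaf K4W :=
  KernelShiftLeafClose.kernelShiftLeaf_of K4W (by norm_num [K4W])

/-- LEAF 2 at C3's wide table `K4W` (`a = 33/1000`, `b = 5/100`). -/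
theorem abelMainLeaf_K4W : AbelMainLeaf K4W :=
  AbelMainLeafClose.abelMainLeaf_of K4W (by norm_num [K4W]) (by norm_num [K4W])

/-- LEAF 3 at C3's wide table `K4W` (`cN = 10⁻⁶`). -/
theorem nearPartnerLeaf_K4W : NearPartnerLeaf K4W :=
  NearPartnerLeaf.nearPartnerLeaf_of K4W (by norm_num [K4W])

/-! ## v4 stub 1 `FarAbel4` -/

/-- ★ **v4 STUB 1 PROVED**: `FarAbel4` — ‖FAR(w) − MAIN(Re w)‖ ≤ errorBudget4 / s(γ) on the box, from the four leaves
at `K4C` (C3's `farAbel4_of_three_leaves_K4C` = `farAbel4_of_leaves K4C · · · ledgerLeaf4_K4C`). -/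
theorem farAbel4 : FarAbel4 :=
  farAbel4_of_three_leaves_K4C kernelShiftLeaf_K4C abelMainLeaf_K4C nearPartnerLeaf_K4C

/-- The same through the generic skeleton socket, with the fourth leaf named explicitly. -/
theorem farAbel4' : FarAbel4 :=
  farAbel4_of_leaves K4C kernelShiftLeaf_K4C abelMainLeaf_K4C nearPartnerLeaf_K4C ledgerLeaf4_K4C

/-- Robustness: the wide table `K4W = ⟨11/1000, 33/1000, 5/100, 1/10^6⟩` closes `FarAbel4` too. -/
theorem farAbel4_K4W : FarAbel4 :=
  farAbel4_of_three_leaves_K4W kernelShiftLeaf_K4W abelMainLeaf_K4W nearPartnerLeaf_K4W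

/-- The registry's stub 1, in the registry's name (ns differs: this is the Theorems side). -/
theorem stub_farAbel4 : FarAbel4 := farAbel4

/-- `FarAbel4` spelled verbatim (v4 registry l.54–58). -/
theorem farAbel4_text :
    ∀ γ : ℝ, T_PT < γ → ∀ w : ℂ, |w.re - γ| ≤ boxHalfWidth → |w.im| ≤ eta0 →
      riemannXiUpper w ≠ 0 →
      ‖farField w - (mainIntegral w.re : ℂ)‖ ≤ errorBudget4 / xiSpacing γ :=
  farAbel4

/-! ## Assembly (registry `remainder0Xi_assembly4` verbatim) and the crux by name -/

/-- Assembly: triangle + the two bounds (v4 registry `remainder0Xi_assembly4`, l.72–88, verbatim). -/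
theorem remainder0Xi_assembly4 (hAbel : FarAbel4) (hSharp : FarLogKernelSharp4) :
    Summit.RiemannHypothesis.RiemannHypothesis.Theses.EarlyAppointments.Remainder0Xi := by
  intro γ hγ w hw_re hw_im hw_ne
  have hAbel' := hAbel γ hγ w hw_re hw_im hw_ne
  have hSharp' := hSharp γ hγ w.re (by convert hw_re using 2)
  have tri : ‖farField w‖ ≤ ‖farField w - (mainIntegral w.re : ℂ)‖ + ‖(mainIntegral w.re : ℂ)‖ := by
    calc ‖farField w‖ = ‖farField w - (mainIntegral w.re : ℂ) + (mainIntegral w.re : ℂ)‖ := by ring_nf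
      _ ≤ ‖farField w - (mainIntegral w.re : ℂ)‖ + ‖(mainIntegral w.re : ℂ)‖ := norm_add_le _ _
  have norm_real : ‖(mainIntegral w.re : ℂ)‖ = |mainIntegral w.re| := Complex.norm_real _
  calc ‖farField w‖
      ≤ ‖farField w - (mainIntegral w.re : ℂ)‖ + |mainIntegral w.re| := by rw [← norm_real]; exact tri
    _ ≤ errorBudget4 / xiSpacing γ + |mainIntegral w.re| := by linarith [hAbel']
    _ ≤ errorBudget4 / xiSpacing γ + (eta0 - errorBudget4) / xiSpacing γ := by linarith [hSharp']
    _ = eta0 / xiSpacing γ := by ring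

/-- ★★★ **THE CRUX ⟨24730⟩ `Remainder0Xi` BY NAME** — route EarlyAppointments, item r3, line rho2_v4:
stub 1 `farAbel4` (this file) + stub 2 `Rho2V4.stub_farLogKernelSharp4` (row 2) through the registry assembly. -/
theorem remainder0Xi : Summit.RiemannHypothesis.RiemannHypothesis.Theses.EarlyAppointments.Remainder0Xi :=
  remainder0Xi_assembly4 farAbel4 stub_farLogKernelSharp4

/-- The route decl's body spelled verbatim (`Theses/EarlyAppointments.lean` l.255 ff.). -/
theorem remainder0Xi_text :
    ∀ γ : ℝ, 3000175332800 < γ → ∀ w : ℂ, |w.re - γ| ≤ 135 / 2 → |w.im| ≤ 1 / 2 →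
      Literature.NumberTheory.LFunctions.riemannXiUpper w ≠ 0 →
      ‖deriv Literature.NumberTheory.LFunctions.riemannXiUpper w / Literature.NumberTheory.LFunctions.riemannXiUpper w -
          ∑ᶠ u ∈ {u : ℂ | Literature.NumberTheory.LFunctions.riemannXiUpper u = 0 ∧ |u.re - w.re| < 135 / 2},
            ((analyticOrderAt Literature.NumberTheory.LFunctions.riemannXiUpper u).toNat : ℂ) * (w - u)⁻¹‖ ≤
        1 / 2 / (2 * Real.pi / Real.log (γ / (2 * Real.pi))) :=
  remainder0Xi

end Summit.RiemannHypothesis.RiemannHypothesis.Theorems.EarlyAppointmentsRemainder0Xi.Close
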